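import Literature.NumberTheory.GaloisRepresentations.IdeleClassBarRelativeInvariant
import Literature.NumberTheory.GaloisRepresentations.IdeleClassInvariantRestriction
import HarnessLib

/-!
# The relative layer `(H_E ≤ Gal(E/F), Res C_E)` at `U = Gal(F̄/L)` IS the layer `(Gal(E/L), C_E)` of the base field `L`:
# `Gal(E/L) ≃* H_E`, `res_{H_E} ≫ T = Res^{E/F}_{E/L}`, and `inv_{H_E} = inv_{E/L} ∘ T` (Serre, *Local Fields* XI §1–§3)

Topic `NumberTheory/GaloisRepresentations`; namespace `Literature.NumberTheory.GaloisRepresentations.IdeleClassBar`.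
Sequel to door-c4 g16's `IdeleClassBarRelativeInvariant.lean` (`relLayerInv` = the class-module invariant `inv_{H_E}` of the
subgroup `H_E = GalLayer.subgroupImage U E ≤ Gal(E/F)` with coefficients `Res C_E`) and door-c5's
`IdeleClassInvariantRestriction.lean` (`classRes F K E n = Hⁿ(τ ↦ τ|^F, id) : Hⁿ(Gal(E/F), C_E) → Hⁿ(Gal(E/K), C_E)`,
`classRes_fundamentalClassAll : Res u_{E/F} = u_{E/K}`).  Definitions with bodies (`galEquivSubgroupImage`,
`subgroupImageToGalCohomology`) and theorems; NO named fact, no `sorry`, no instance, no notation.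

THE POINT.  For layers `L ≤ E` of `F̄/F` and `U = U_L = Gal(F̄/L)`, the image `H_E` of `U` in `Gal(E/F)` is the image of
`Gal(E/L) ↪ Gal(E/F)`, `σ ↦ σ|^F` (`range_restrictScalarsHom_eq_subgroupImage`), whence **`Gal(E/L) ≃* H_E`**
(`galEquivSubgroupImage`), the comparison **`T : Hⁿ(H_E, Res C_E) ⟶ Hⁿ(Gal(E/L), C_E)`** (`subgroupImageToGalCohomology`,
`groupCohomology.map` along it with the identity on `C_E`) with **`res_{H_E} ≫ T = classRes F L E n`**, `|H_E| = [E:L]`, and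
**`inv_{H_E} = inv_{E/L} ∘ T`** (`invSub_eq_classInvAll_comp`): door-c4's relative invariants ARE the cell's invariant maps
`classInvAll L E` of the base field `L`.  This is the bridge through which door-c6 g13/g14's reciprocity computations
(`inv_{E/L}(ι[x] ∪ β_m χ) = −χ(ψ_{E/L} x)/m`, stated for `classInvAll L E`) reach the relative layers of `(U, Res_U C̄)` —
the remaining input of the field `adjointBijective_one_zmod` (door-c4 g16 `DiscreteRepModPairingLayers`).

HONEST FRAMING: Galois-theory bookkeeping; no case of BSD or of Poitou–Tate is proved.  Route A (A5)-ARITH of crux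
`AnticycControlAdditiveK` (item 19295, cell bsd-schneider), seat door-c4 gen 16.

## References
* J.-P. Serre, *Local Fields*, GTM 67 (1979), XI §1 (iv), §2 Proposition 1, §3. [Serre1979]
* J. W. S. Cassels, A. Fröhlich (eds.), *Algebraic Number Theory* (1967), Ch. VII (J. Tate) §11.3 (12). [CasselsFrohlichANT1967]
-/

noncomputable section

open NumberField CategoryTheory groupCohomology
open Field (absoluteGaloisGroup)
open Literature.NumberTheory.Automorphic Literature.NumberTheory.Automorphic.IdeleClassGroup
open Literature.NumberTheory.NumberFields
open Literature.Algebra.Homology Literature.Algebra.Homology.DiscreteRep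
open scoped Classical

namespace Literature.NumberTheory.GaloisRepresentations

namespace IdeleClassBar

variable {F : Type} [Field F] [NumberField F] {L E : GalLayer F} (h : L ≤ E)

/-! ## §20. `Gal(E/L) ≃* H_E` -/

/-- `Gal(E/L) →* Gal(E/F)`, `σ ↦ σ|^F` (Mathlib `AlgEquiv.restrictScalarsHom`, for the algebra structure `L ≤ E`).
[cite: Serre1979, XI §1] -/
abbrev galResHom (h : L ≤ E) : (letI := GalLayer.algebraOfLE h; (E.1 ≃ₐ[L.1] E.1)) →* (E.1 ≃ₐ[F] E.1) :=
  letI := GalLayer.algebraOfLE h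
  AlgEquiv.restrictScalarsHom F

omit [NumberField F] in
/-- **The image of `Gal(E/L) → Gal(E/F)` is `H_E`, the image of `U_L = Gal(F̄/L)` in `Gal(E/F)`** (an `L`-linear
automorphism of `E` lifts to `F̄` fixing `L`; conversely `σ|_E` is `L`-linear for `σ` fixing `L`).
[cite: Serre1979, XI §1 (iv)] -/
theorem range_galResHom_eq_subgroupImage :
    (galResHom h).range =
      GalLayer.subgroupImage (L.openNormalSubgroup : Subgroup (absoluteGaloisGroup F)) E := by
  letI := GalLayer.algebraOfLE h
  haveI := E.isGalois
  ext τ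
  constructor
  · rintro ⟨σ', rfl⟩
    obtain ⟨σ, hσ⟩ := E.restrictHom_surjective (galResHom h σ')
    refine Subgroup.mem_map.2 ⟨σ, (IntermediateField.mem_fixingSubgroup_iff _ _).2 fun x hx => ?_, hσ⟩
    have h1 := GalLayer.coe_restrictHom_apply E σ ⟨x, h hx⟩
    rw [hσ] at h1
    have h2 : galResHom h σ' ⟨x, h hx⟩ = ⟨x, h hx⟩ := σ'.commutes ⟨x, hx⟩
    rw [h2] at h1
    exact h1.symm
  · intro hτ
    obtain ⟨σ, hσ, rfl⟩ := Subgroup.mem_map.1 hτ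
    have hfix : ∀ x : L.1, E.restrictHom σ (algebraMap L.1 E.1 x) = algebraMap L.1 E.1 x := fun x => by
      apply Subtype.ext
      rw [GalLayer.coe_restrictHom_apply]
      have hσ' : σ ∈ L.1.fixingSubgroup := hσ
      exact (IntermediateField.mem_fixingSubgroup_iff _ _).1 hσ' x x.2
    exact ⟨{ (E.restrictHom σ : E.1 ≃ₐ[F] E.1).toRingEquiv with commutes' := hfix }, AlgEquiv.ext fun _ => rfl⟩

/-- **`Gal(E/L) ≃* H_E`.** [cite: Serre1979, XI §1 (iv)] -/
def galEquivSubgroupImage :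
    (letI := GalLayer.algebraOfLE h; (E.1 ≃ₐ[L.1] E.1)) ≃*
      GalLayer.subgroupImage (L.openNormalSubgroup : Subgroup (absoluteGaloisGroup F)) E :=
  letI := GalLayer.algebraOfLE h
  (MonoidHom.ofInjective (f := galResHom h) (AlgEquiv.restrictScalarsHom_injective F)).trans
    (MulEquiv.subgroupCongr (range_galResHom_eq_subgroupImage h))

omit [NumberField F] in
/-- Formula: `(galEquivSubgroupImage σ : Gal(E/F)) = σ|^F`. [cite: Serre1979, XI §1 (iv)] -/
theorem coe_galEquivSubgroupImage (σ : (letI := GalLayer.algebraOfLE h; (E.1 ≃ₐ[L.1] E.1))) :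
    ((galEquivSubgroupImage h σ : GalLayer.subgroupImage (L.openNormalSubgroup : Subgroup (absoluteGaloisGroup F)) E) :
      E.1 ≃ₐ[F] E.1) = galResHom h σ := rfl

omit [NumberField F] in
/-- `H_E.subtype ∘ galEquivSubgroupImage = galResHom`. [cite: Serre1979, XI §1 (iv)] -/
theorem subtype_comp_galEquivSubgroupImage :
    (GalLayer.subgroupImage (L.openNormalSubgroup : Subgroup (absoluteGaloisGroup F)) E).subtype.comp
        (galEquivSubgroupImage h).toMonoidHom = galResHom h := rfl

omit [NumberField F] in
/-- **`|H_E| = [E:L]`.** [cite: Serre1979, XI §1 (iv)] -/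
theorem natCard_subgroupImage_eq_finrank :
    Nat.card (GalLayer.subgroupImage (L.openNormalSubgroup : Subgroup (absoluteGaloisGroup F)) E) =
      (letI := GalLayer.algebraOfLE h; Module.finrank L.1 E.1) := by
  letI := GalLayer.algebraOfLE h
  haveI := GalLayer.isScalarTower_of_le h
  haveI := E.finiteDimensional
  haveI := E.isGalois
  haveI : IsGalois L.1 E.1 := IsGalois.tower_top_of_isGalois F L.1 E.1
  haveI : FiniteDimensional L.1 E.1 := Module.Finite.of_restrictScalars_finite F L.1 E.1
  rw [← Nat.card_congr (galEquivSubgroupImage h).toEquiv, IsGalois.card_aut_eq_finrank]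

/-! ## §21. `res_{H_E} ≫ T = Res^{E/F}_{E/L}` -/

/-- The identity `C_E → C_E` as a morphism `Res_{galEquiv} (Res_{H_E} C_E) ⟶ galoisRep L E` of `Gal(E/L)`-modules.
[cite: Serre1979, XI §1] -/
def subgroupImageToGalRepHom :
    Rep.res (galEquivSubgroupImage h).toMonoidHom
        (Rep.res (GalLayer.subgroupImage (L.openNormalSubgroup : Subgroup (absoluteGaloisGroup F)) E).subtype
          ((classData F).obj E)) ⟶
      (letI := GalLayer.algebraOfLE h; haveI := L.numberField; haveI := E.numberField;
        IdeleClassGroup.galoisRep L.1 E.1) :=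
  letI := GalLayer.algebraOfLE h
  haveI := GalLayer.isScalarTower_of_le h
  haveI := L.numberField
  haveI := E.numberField
  Rep.ofHom ⟨LinearMap.id, fun σ => LinearMap.ext fun a => by
    change (IdeleClassGroup.galoisRep F E.1).ρ (AlgEquiv.restrictScalarsHom F σ) a =
      (IdeleClassGroup.galoisRep L.1 E.1).ρ σ a
    rw [IdeleClassGroup.galoisRep_ρ_apply, IdeleClassGroup.galoisRep_ρ_apply, AlgEquiv.restrictScalarsHom_apply,
      IdeleClassGroup.classGalAct_restrictScalars]⟩

/-- **`T : Hⁿ(H_E, Res C_E) ⟶ Hⁿ(Gal(E/L), C_E)`**, the comparison along `Gal(E/L) ≃* H_E` (identity on `C_E`).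
[cite: Serre1979, XI §1][cite: CasselsFrohlichANT1967, Ch. VII §11.3 (12)] -/
def subgroupImageToGalCohomology (n : ℕ) :
    groupCohomology (Rep.res (GalLayer.subgroupImage (L.openNormalSubgroup : Subgroup (absoluteGaloisGroup F)) E).subtype
        ((classData F).obj E)) n ⟶
      groupCohomology (letI := GalLayer.algebraOfLE h; haveI := L.numberField; haveI := E.numberField;
        IdeleClassGroup.galoisRep L.1 E.1) n :=
  groupCohomology.map (galEquivSubgroupImage h).toMonoidHom (subgroupImageToGalRepHom h) n

set_option maxHeartbeats 1600000 in
-- `map_comp` / `map_congr'` against the `ℤ`-instance paths of `H²(H_E, Res C_E)` (cf. door-c6 `stepG_comp_relLayerCohomologyIso`)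
/-- **`res_{H_E} ≫ T = classRes F L E n`**: restricting from `Gal(E/F)` to `H_E` and comparing with `Gal(E/L)` is door-c5's
restriction `Res : Hⁿ(Gal(E/F), C_E) → Hⁿ(Gal(E/L), C_E)`. [cite: Serre1979, XI §1][cite: CasselsFrohlichANT1967, Ch. VII §11.3 (12)] -/
theorem res_comp_subgroupImageToGalCohomology (n : ℕ) :
    groupCohomology.map (GalLayer.subgroupImage (L.openNormalSubgroup : Subgroup (absoluteGaloisGroup F)) E).subtype
        (𝟙 (Rep.res (GalLayer.subgroupImage (L.openNormalSubgroup : Subgroup (absoluteGaloisGroup F)) E).subtype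
          ((classData F).obj E))) n ≫ subgroupImageToGalCohomology h n =
      (letI := GalLayer.algebraOfLE h; haveI := GalLayer.isScalarTower_of_le h; haveI := L.numberField;
        haveI := E.numberField; IdeleCohomology.classRes F L.1 E.1 n) := by
  letI := GalLayer.algebraOfLE h
  haveI := GalLayer.isScalarTower_of_le h
  haveI := L.numberField
  haveI := E.numberField
  rw [subgroupImageToGalCohomology, IdeleCohomology.classRes, ← groupCohomology.map_comp]
  exact map_congr' (subtype_comp_galEquivSubgroupImage h) _ _ (fun _ => rfl) n

/-! ## §22. `inv_{H_E} = inv_{E/L} ∘ T` -/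

set_option maxHeartbeats 1000000 in
-- coercion bookkeeping `⇑(L.toAddMonoidHom) = ⇑L` against the `ℤ`-instance paths of `H²(H_E, Res C_E)` is slow
/-- **The relative invariant of door-c4 IS the invariant map of the base field `L`**: `inv_{H_E} = classInvAll L E ∘ T`
(both are additive on the cyclic `H²(H_E, Res C_E) = ℤ · res u_{E/F}` with `T (res u_{E/F}) = Res u_{E/F} = u_{E/L}` of invariant
`1/[E:L] = 1/|H_E|`). [cite: Serre1979, XI §2 Proposition 1, §3][cite: CasselsFrohlichANT1967, Ch. VII §11.3] -/
theorem invSub_eq_classInvAll_comp :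
    (haveI := finite_gal F E;
      (isClassModule_layerCocycle F E).invSub
        (GalLayer.subgroupImage (L.openNormalSubgroup : Subgroup (absoluteGaloisGroup F)) E)) =
      (letI := GalLayer.algebraOfLE h; haveI := GalLayer.isScalarTower_of_le h; haveI := L.numberField;
        haveI := E.numberField; haveI := E.isGalois; haveI : IsGalois L.1 E.1 := IsGalois.tower_top_of_isGalois F L.1 E.1;
        (IdeleCohomology.classInvAll L.1 E.1).comp (subgroupImageToGalCohomology h 2).hom.toAddMonoidHom) := by
  letI := GalLayer.algebraOfLE h
  haveI := GalLayer.isScalarTower_of_le h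
  haveI := L.numberField
  haveI := E.numberField
  haveI := E.isGalois
  haveI : IsGalois L.1 E.1 := IsGalois.tower_top_of_isGalois F L.1 E.1
  haveI := finite_gal F E
  haveI := IdeleCohomology.neZero_finrank L.1 E.1
  symm
  refine (isClassModule_layerCocycle F E).eq_invSub_of_apply _ _ ?_
  -- value on `res u_{E/F}`: `T (res u_{E/F}) = classRes u_{E/F} = u_{E/L}`, of invariant `1/[E:L] = 1/|H_E|`
  have hT : (subgroupImageToGalCohomology h 2)
      (groupCohomology.map (GalLayer.subgroupImage (L.openNormalSubgroup : Subgroup (absoluteGaloisGroup F)) E).subtype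
        (𝟙 (Rep.res (GalLayer.subgroupImage (L.openNormalSubgroup : Subgroup (absoluteGaloisGroup F)) E).subtype
          ((classData F).obj E))) 2 (H2π ((classData F).obj E) (layerCocycle F E))) =
      IdeleCohomology.fundamentalClassAll L.1 E.1 := by
    rw [← ModuleCat.comp_apply, res_comp_subgroupImageToGalCohomology h 2, H2π_layerCocycle]
    exact IdeleCohomology.classRes_fundamentalClassAll F L.1 E.1
  rw [AddMonoidHom.coe_comp, Function.comp_apply, LinearMap.toAddMonoidHom_coe]
  change IdeleCohomology.classInvAll L.1 E.1 ((subgroupImageToGalCohomology h 2) _) = _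
  rw [hT, IdeleCohomology.classInvAll_fundamentalClassAll, natCard_subgroupImage_eq_finrank h, oneDiv_eq_zmodToQmodZ]

set_option maxHeartbeats 1000000 in
-- as above
/-- Pointwise form: **`inv_{H_E} (x) = inv_{E/L} (T x)`**. [cite: Serre1979, XI §2 Proposition 1, §3] -/
theorem invSub_apply_eq_classInvAll
    (x : groupCohomology (Rep.res (GalLayer.subgroupImage (L.openNormalSubgroup : Subgroup (absoluteGaloisGroup F)) E).subtype
      ((classData F).obj E)) 2) :
    (haveI := finite_gal F E;
      (isClassModule_layerCocycle F E).invSub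
        (GalLayer.subgroupImage (L.openNormalSubgroup : Subgroup (absoluteGaloisGroup F)) E) x) =
      (letI := GalLayer.algebraOfLE h; haveI := GalLayer.isScalarTower_of_le h; haveI := L.numberField;
        haveI := E.numberField; haveI := E.isGalois; haveI : IsGalois L.1 E.1 := IsGalois.tower_top_of_isGalois F L.1 E.1;
        IdeleCohomology.classInvAll L.1 E.1 (subgroupImageToGalCohomology h 2 x)) := by
  have hx := DFunLike.congr_fun (invSub_eq_classInvAll_comp h) x
  rw [AddMonoidHom.coe_comp, Function.comp_apply, LinearMap.toAddMonoidHom_coe] at hx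
  exact hx

end IdeleClassBar

end Literature.NumberTheory.GaloisRepresentations

end
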